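import Summits.QuantumAdvantage.AdviceFreeQNC0.LiftOneUBookkeeping
import HarnessLib

/-!
# Cell qa-qnc0 (rung F-S1, route RingFrame, crux α, line `tensor`): the radius modulus `RadiusDecay`
# and the bookkeeping `LiftOneU → RadiusDecay` (qn-p2 ROUND-6 §2, ask R6-b)

Planner qa-qnc0-p2's ROUND-6 isolates what the composite `TRPlus` actually needs from the unique-decoding
radius: not R1U (`LiftOneU`, lift cost `≤ K(d+2)·w·2^L`) but only the MODULUS `RadiusDecay` — lift cost
`≤ ε·2^{L'}·2^L` for every `ε > 0` once the order `d` is large, uniformly in `L, L'` and in the radius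
`w ≤ 2^{L'−d−1}` (equivalently `γ_d = o(2^d)`; OPEN).  This file types both statements VERBATIM from
`HOME/qa-qnc0-p2/line/Sketch6.lean` and proves the bookkeeping implication

* `radiusDecay_of_liftOneU : RadiusDecayOfLiftOneU` (`LiftOneU → RadiusDecay`): with `w ≤ 2^{L'−d−1}`,
  `K(d+2)·w·2^L ≤ K(d+2)·2^{−(d+1)}·2^{L'}·2^L ≤ ε·2^{L'}·2^L` as soon as `K(d+2) ≤ ε·2^{d+1}`, which holds for
  `d ≥ max 4 ⌈K/ε⌉` (`2^d ≥ d²` for `d ≥ 4`, inline); the case `L' ≤ d` forces `w = 0`.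

The cell's lemma (planner qa-qnc0-p2 gen 6; seat qa-qnc0-lit gen 11, 2026-08-27).  WHAT THIS IS NOT: `RadiusDecay`
itself stays OPEN (conjecture of record); nothing on `TRPlus`, α or the separation.
-/

noncomputable section

namespace Summit.QuantumAdvantage.AdviceFreeQNC0

open Finset

/-- **RADIUS DECAY** (qn-p2 ROUND-6 §2, `Sketch6.RadiusDecay` verbatim): for every `ε > 0` there is `d₀` such
that for all `d ≥ d₀`, all `L, L'` and all `w` up to the unique-decoding radius, a matrix with linear columns whose
rows are `w`-close to `RM(d,L')` is `ε·2^{L'}·2^L`-close to one with linear columns and rows in `RM(d,L')`.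
OPEN (conjecture of record; strictly weaker than `LiftOneU`). -/
def RadiusDecay : Prop :=
  ∀ ε : ℝ, 0 < ε → ∃ d₀ : ℕ, ∀ L L' d w : ℕ, d₀ ≤ d → 2 * w ≤ 2 ^ (L' - d) →
    ∀ X Y : BMat L L', LinCols X → RowsDeg d Y → (∀ u, rowDist X Y u ≤ w) →
      ∃ W : BMat L L', LinCols W ∧ RowsDeg d W ∧
        (hw (xorM X W) : ℝ) ≤ ε * (2 : ℝ) ^ L' * (2 : ℝ) ^ L

/-- bookkeeping (support; `Sketch6.RadiusDecayOfLiftOneU` verbatim): `LiftOneU → RadiusDecay`. -/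
def RadiusDecayOfLiftOneU : Prop := LiftOneU → RadiusDecay

namespace RadiusDecay

/-- The threshold: for `d ≥ 4` with `K ≤ ε·d` one has `K·(d+2) ≤ ε·2^{d+1}`. -/
theorem const_le (K ε : ℝ) (hε : 0 < ε) {d : ℕ} (hd4 : 4 ≤ d) (hKd : K ≤ ε * d) :
    K * ((d : ℝ) + 2) ≤ ε * (2 : ℝ) ^ (d + 1) := by
  -- `d² ≤ 2^d` for `d ≥ 4` (also `Literature.NumberTheory.Transcendental.OddZeta.sq_le_two_pow`; re-derived
  -- inline to keep this cell file free of the zeta-function import)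
  have hsqN : ∀ k : ℕ, 4 ≤ k → k ^ 2 ≤ 2 ^ k := by
    intro k hk
    induction k with
    | zero => omega
    | succ k ih =>
      rcases Nat.lt_or_ge k 4 with hk4 | hk4
      · obtain rfl : k = 3 := by omega
        norm_num
      · have h := ih hk4
        have hk2 : 2 * k + 1 ≤ k ^ 2 := by nlinarith
        calc (k + 1) ^ 2 = k ^ 2 + (2 * k + 1) := by ring
          _ ≤ 2 ^ k + 2 ^ k := Nat.add_le_add h (hk2.trans h)
          _ = 2 ^ (k + 1) := by ring
  have hsq : ((d : ℝ)) ^ 2 ≤ (2 : ℝ) ^ d := by exact_mod_cast hsqN d hd4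
  have hd : (4 : ℝ) ≤ d := by exact_mod_cast hd4
  have h1 : K * ((d : ℝ) + 2) ≤ ε * d * ((d : ℝ) + 2) :=
    mul_le_mul_of_nonneg_right hKd (by positivity)
  have h2 : (d : ℝ) * ((d : ℝ) + 2) ≤ 2 * (d : ℝ) ^ 2 := by nlinarith
  calc K * ((d : ℝ) + 2) ≤ ε * d * ((d : ℝ) + 2) := h1
    _ = ε * (d * ((d : ℝ) + 2)) := by ring
    _ ≤ ε * (2 * (d : ℝ) ^ 2) := mul_le_mul_of_nonneg_left h2 hε.le
    _ ≤ ε * (2 * (2 : ℝ) ^ d) := mul_le_mul_of_nonneg_left (by linarith) hε.le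
    _ = ε * (2 : ℝ) ^ (d + 1) := by ring

end RadiusDecay

/-- **`LiftOneU → RadiusDecay`** (qn-p2 ROUND-6 §2 bookkeeping, ask R6-b): the R1U cost `K(d+2)·w·2^L` at the
radius `w ≤ 2^{L'−d−1}` is `≤ K(d+2)2^{−(d+1)}·2^{L'}·2^L ≤ ε·2^{L'}·2^L` once `K(d+2) ≤ ε·2^{d+1}`. -/
theorem radiusDecay_of_liftOneU : RadiusDecayOfLiftOneU := by
  rintro ⟨K, hK, hlift⟩ ε hε
  -- the threshold `d₀ = max 4 ⌈K/ε⌉`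
  obtain ⟨N, hN⟩ := exists_nat_ge (K / ε)
  refine ⟨max 4 N, fun L L' d w hd hw X Y hX hY hdist => ?_⟩
  obtain ⟨W, hW, hWd, hcost⟩ := hlift L L' d w hw X Y hX hY hdist
  refine ⟨W, hW, hWd, hcost.trans ?_⟩
  have hd4 : 4 ≤ d := le_trans (le_max_left _ _) hd
  have hdN : N ≤ d := le_trans (le_max_right _ _) hd
  have hKd : K ≤ ε * d := by
    have h1 : K / ε ≤ d := hN.trans (by exact_mod_cast hdN)
    rwa [div_le_iff₀ hε, mul_comm] at h1
  have hconst := RadiusDecay.const_le K ε hε hd4 hKd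
  have h2L : (0 : ℝ) ≤ (2 : ℝ) ^ L := by positivity
  rcases Nat.lt_or_ge L' (d + 1) with hL' | hL'
  · -- `L' ≤ d`: the radius hypothesis forces `w = 0`
    have hw0 : w = 0 := by
      have : L' - d = 0 := by omega
      rw [this, pow_zero] at hw
      omega
    subst hw0
    simp only [Nat.cast_zero, mul_zero, zero_mul]
    positivity
  · -- `L' ≥ d + 1`: `2w ≤ 2^{L'-d}` gives `w·2^{d+1} ≤ 2^{L'}`
    have hwpow : (w : ℝ) * (2 : ℝ) ^ (d + 1) ≤ (2 : ℝ) ^ L' := by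
      have hnat : w * 2 ^ (d + 1) ≤ 2 ^ L' := by
        have e : 2 ^ L' = 2 ^ (L' - d) * 2 ^ d := by rw [← pow_add]; congr 1; omega
        rw [e, pow_succ]
        calc w * (2 ^ d * 2) = 2 * w * 2 ^ d := by ring
          _ ≤ 2 ^ (L' - d) * 2 ^ d := Nat.mul_le_mul_right _ hw
      exact_mod_cast hnat
    -- `K(d+2)·w·2^L ≤ ε·2^{d+1}·w·2^L/… ≤ ε·2^{L'}·2^L`
    have hd2 : (0 : ℝ) ≤ (d : ℝ) + 2 := by positivity
    calc K * ((d : ℝ) + 2) * w * (2 : ℝ) ^ L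
        = (K * ((d : ℝ) + 2)) * ((w : ℝ) * (2 : ℝ) ^ L) := by ring
      _ ≤ (ε * (2 : ℝ) ^ (d + 1)) * ((w : ℝ) * (2 : ℝ) ^ L) :=
          mul_le_mul_of_nonneg_right hconst (by positivity)
      _ = ε * ((w : ℝ) * (2 : ℝ) ^ (d + 1)) * (2 : ℝ) ^ L := by ring
      _ ≤ ε * (2 : ℝ) ^ L' * (2 : ℝ) ^ L :=
          mul_le_mul_of_nonneg_right (mul_le_mul_of_nonneg_left hwpow hε.le) h2L

end Summit.QuantumAdvantage.AdviceFreeQNC0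

end
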